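import Literature.NumberTheory.LFunctions.WeilArchDensityPanelTM
import Literature.Analysis.ValidatedNumerics.ExpPoly.CorrelationCert
import HarnessLib

/-!
# The archimedean density of Weil's explicit formula, V: kernel checks per panel and for the tail

Topic `Literature/NumberTheory/LFunctions` (sequel of `WeilArchDensityPanelTM.lean`).  Boolean certificates evaluated
by the kernel (`decide +kernel`), each sized to a few seconds of kernel time (a single `decide` over all panels of a
window exceeds the kernel budget, so the certificate is CHUNKED: one theorem per panel, assembled by
`archBulk_of_panels`), with soundness theorems:

* `archPanelCheck … k Q e p E s Ilo Ihi` / `archPanelCheck_sound` (panels in `τ = t/s`, slope `s`, half-width `h`,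
  centres `c_k = (2k+1)h`): if the panel model of `σ ↦ g(s c_k + sσ)` is accepted
  (`gPanelCheck`) and the exact rational `∫_{-h}^{h} p · q_k` lies in `[Ilo + err_k, Ihi − err_k]`,
  `err_k = (tabsI(G_k − p)/S)·2h·Σₙ|q_{k,n}|hⁿ`, then
  `Ilo ≤ ∫_{-h}^{h} g(s c_k + sσ) E(c_k + σ) dσ ≤ Ihi` (`q_k = taylorShiftH E c_k` of `ExpPoly/CorrelationCert.lean`);
* `archBulk_of_panels`: summing the per-panel enclosures, with `integral_weilArchDensityG_slope_mul_eval_eq_sum`: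
  `∫₀^{2Nh} g(sτ)E(τ) dτ = Σ_k ∫_{-h}^{h} g(s c_k + sσ) E(c_k + σ) dσ`;
* `archTailBounds … M b = (Tlo, Thi)` / `archTailCheck` / `archTail_sound`: `Tlo ≤ ∫_{(2b,∞)} ρ ≤ Thi` from the
  exponential series (`weilArchDensity_tail_eq_sum_add`, `M` terms, `MI.expPt` enclosures of `e^{-(2m+½)2b}`).

## References

* E. Bombieri, Rend. Mat. Acc. Lincei (9) 11 (2000) 183–233, Thm 2. [cite: Bombieri2000Weil, Thm 2]
* K. Makino, M. Berz, Int. J. Pure Appl. Math. 4 (2003) 379–456, §6. [folklore]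
-/

open Real Set MeasureTheory intervalIntegral Finset


namespace Literature.NumberTheory.LFunctions

open Literature.Analysis.ValidatedNumerics.PolyMP Literature.Analysis.ValidatedNumerics.NumericsMP
open Literature.Analysis.ValidatedNumerics.ExpPoly (Poly)
open Literature.Analysis.ValidatedNumerics.ExpPoly

/-! ## Panels -/

/-- The centre `c_k = (2k+1)h₂` of panel `k`. [folklore] -/
def panelCentre (h₂ : ℚ) (k : ℕ) : ℚ := ((2 * k + 1 : ℕ) : ℚ) * h₂

/-- `τ ↦ g(sτ) · E(τ)` is interval integrable on subintervals of `[0, ∞)` (`s > 0`). [folklore] -/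
theorem intervalIntegrable_weilArchDensityG_slope_mul {s : ℝ} (hs : 0 < s) (E : Poly) {a b : ℝ} (ha : 0 ≤ a)
    (hab : a ≤ b) : IntervalIntegrable (fun τ ↦ weilArchDensityG (s * τ) * Poly.eval E τ) volume a b := by
  have h1 := (intervalIntegrable_weilArchDensityG (a := s * a) (b := s * b) (by positivity)
    (mul_le_mul_of_nonneg_left hab hs.le)).comp_mul_left (c := s)
  have e1 : s * a / s = a := by field_simp
  have e2 : s * b / s = b := by field_simp
  rw [e1, e2] at h1
  exact h1.mul_continuousOn (Poly.continuous_eval E).continuousOn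

/-- **Panel decomposition with slope**: `∫₀^{2Nh} g(sτ) E(τ) dτ = Σ_{k<N} ∫_{-h}^{h} g(s c_k + s σ) E(c_k + σ) dσ`,
`c_k = (2k+1)h`. [folklore] -/
theorem integral_weilArchDensityG_slope_mul_eval_eq_sum (E : Poly) {s : ℚ} (hs : 0 < s) {h : ℚ} (hh : 0 < h) (N : ℕ) :
    ∫ τ in (0 : ℝ)..(2 * N * h), weilArchDensityG ((s : ℝ) * τ) * Poly.eval E τ =
      ∑ k ∈ Finset.range N, ∫ σ in (-(h : ℝ))..h,
        weilArchDensityG (((s * panelCentre h k : ℚ) : ℝ) + s * σ) * Poly.eval E ((panelCentre h k : ℚ) + σ) := by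
  have hhr : (0 : ℝ) ≤ h := by exact_mod_cast hh.le
  rw [intervalIntegral_eq_sum_panels (fun τ ↦ weilArchDensityG ((s : ℝ) * τ) * Poly.eval E τ) hhr
    (fun a b ha hab ↦ intervalIntegrable_weilArchDensityG_slope_mul (by exact_mod_cast hs) E ha hab) N]
  refine Finset.sum_congr rfl fun k _ ↦ integral_congr fun ρ _ ↦ ?_
  simp only [panelCentre]
  push_cast
  ring_nf

/-- The error budget of panel `k`: `(tabsI(G_k − p)/S)·(2h·Σₙ|q_{k,n}|hⁿ)`. [folklore] -/
def archPanelErr (S : ℕ) (h : ℚ) (D K Ke ke k : ℕ) (Q : List ℤ) (e : ℕ) (p qk : Poly) (s : ℚ) : ℚ :=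
  ((tabsI S h (tsubI (gPanelI S h D K Ke ke (s * panelCentre h k) s Q e) (ratPolyI S p)) : ℚ) / S) *
    (2 * h * absBoundQ qk h)

/-- **The panel certificate** (slope `s`, i.e. `t = sτ`): panel model accepted and the exact part `∫ p q_k` inside
`[Ilo + err, Ihi − err]`, `q_k = taylorShiftH E c_k`. [folklore] -/
def archPanelCheck (S : ℕ) (h : ℚ) (D K Kφ lam Ke ke k : ℕ) (Q : List ℤ) (e : ℕ) (p E : Poly) (s : ℚ)
    (Ilo Ihi : ℚ) : Bool :=
  let qk := Poly.taylorShiftH E (panelCentre h k)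
  let I := integPolyQ p qk h
  let err := archPanelErr S h D K Ke ke k Q e p qk s
  gPanelCheck S h D Kφ lam Ke ke (s * panelCentre h k) s Q e && decide (Ilo + err ≤ I) && decide (I + err ≤ Ihi)

/-- **Soundness of the panel certificate.** [folklore] -/
theorem archPanelCheck_sound {S : ℕ} (hS : 0 < S) {h : ℚ} (h0 : 0 < h) {s : ℚ} (hs : 0 < s) (hsh : s * h ≤ 2)
    {D K Kφ lam Ke ke k : ℕ} (hK : 0 < K) (hKφ : 0 < Kφ) (hlam : 0 < lam) {Q : List ℤ} {e : ℕ} {p E : Poly}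
    {Ilo Ihi : ℚ} (hchk : archPanelCheck S h D K Kφ lam Ke ke k Q e p E s Ilo Ihi = true) :
    (Ilo : ℝ) ≤ ∫ σ in (-(h : ℝ))..h,
        weilArchDensityG (((s * panelCentre h k : ℚ) : ℝ) + s * σ) * Poly.eval E ((panelCentre h k : ℚ) + σ) ∧
      ∫ σ in (-(h : ℝ))..h,
        weilArchDensityG (((s * panelCentre h k : ℚ) : ℝ) + s * σ) * Poly.eval E ((panelCentre h k : ℚ) + σ) ≤
          (Ihi : ℝ) := by
  unfold archPanelCheck at hchk
  simp only [Bool.and_eq_true, decide_eq_true_eq] at hchk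
  obtain ⟨⟨hg, hlo⟩, hhi⟩ := hchk
  have hc : s * h ≤ s * panelCentre h k := by
    refine mul_le_mul_of_nonneg_left ?_ hs.le
    unfold panelCentre
    have : (1 : ℚ) ≤ ((2 * k + 1 : ℕ) : ℚ) := by exact_mod_cast Nat.le_add_left 1 (2 * k)
    nlinarith
  have hest := abs_panelIntegral_sub_le hS h0.le hs hsh hK hKφ hlam hc hg p (Poly.taylorShiftH E (panelCentre h k))
  have heq : (∫ σ in (-(h : ℝ))..h, weilArchDensityG (((s * panelCentre h k : ℚ) : ℝ) + s * σ) *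
        Poly.eval (Poly.taylorShiftH E (panelCentre h k)) σ) =
      ∫ σ in (-(h : ℝ))..h, weilArchDensityG (((s * panelCentre h k : ℚ) : ℝ) + s * σ) *
        Poly.eval E ((panelCentre h k : ℚ) + σ) :=
    integral_congr fun σ _ ↦ by simp only [Poly.eval_taylorShiftH]
  rw [heq] at hest
  have hloR : ((Ilo : ℚ) : ℝ) +
      (archPanelErr S h D K Ke ke k Q e p (Poly.taylorShiftH E (panelCentre h k)) s : ℝ) ≤
      (integPolyQ p (Poly.taylorShiftH E (panelCentre h k)) h : ℝ) := by exact_mod_cast hlo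
  have hhiR : (integPolyQ p (Poly.taylorShiftH E (panelCentre h k)) h : ℝ) +
      (archPanelErr S h D K Ke ke k Q e p (Poly.taylorShiftH E (panelCentre h k)) s : ℝ) ≤ ((Ihi : ℚ) : ℝ) := by
    exact_mod_cast hhi
  unfold archPanelErr at hloR hhiR
  push_cast at hloR hhiR hest ⊢
  constructor <;> linarith [(abs_le.1 hest).1, (abs_le.1 hest).2]

/-- **Assembling the panels**: per-panel enclosures `[Ilo_k, Ihi_k]` sum to an enclosure of `∫₀^{2Nh} g(sτ)E(τ) dτ`.
[folklore] -/
theorem archBulk_of_panels {S : ℕ} (hS : 0 < S) {h : ℚ} (h0 : 0 < h) {s : ℚ} (hs : 0 < s) (hsh : s * h ≤ 2)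
    {D K Kφ lam Ke ke : ℕ} (hK : 0 < K) (hKφ : 0 < Kφ) (hlam : 0 < lam) {E : Poly} (N : ℕ) (Q : ℕ → List ℤ)
    (e : ℕ → ℕ) (p : ℕ → Poly) (Ilo Ihi : ℕ → ℚ)
    (hall : ∀ k, k < N → archPanelCheck S h D K Kφ lam Ke ke k (Q k) (e k) (p k) E s (Ilo k) (Ihi k) = true) :
    ((∑ k ∈ Finset.range N, Ilo k : ℚ) : ℝ) ≤ ∫ τ in (0 : ℝ)..(2 * N * h), weilArchDensityG ((s : ℝ) * τ) * Poly.eval E τ ∧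
      ∫ τ in (0 : ℝ)..(2 * N * h), weilArchDensityG ((s : ℝ) * τ) * Poly.eval E τ ≤
        ((∑ k ∈ Finset.range N, Ihi k : ℚ) : ℝ) := by
  rw [integral_weilArchDensityG_slope_mul_eval_eq_sum E hs h0 N]
  push_cast
  constructor
  · exact Finset.sum_le_sum fun k hk ↦ by
      have h1 := (archPanelCheck_sound hS h0 hs hsh hK hKφ hlam (hall k (Finset.mem_range.1 hk))).1
      push_cast at h1 ⊢; exact h1
  · exact Finset.sum_le_sum fun k hk ↦ by
      have h1 := (archPanelCheck_sound hS h0 hs hsh hK hKφ hlam (hall k (Finset.mem_range.1 hk))).2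
      push_cast at h1 ⊢; exact h1

/-! ## The tail -/

/-- Lower and upper rational bounds of `∫_{(2b,∞)} ρ` from `M` terms of the exponential series. [folklore] -/
def archTailBounds (S Ke ke M : ℕ) (b : ℚ) : ℚ × ℚ :=
  let term : ℕ → MI := fun m ↦ expRatMI S Ke ke (-((2 * m + 1 / 2 : ℚ) * (2 * b)))
  let lo : ℚ := ∑ m ∈ Finset.range M, ((term m).lo : ℚ) / S / (2 * m + 1 / 2 : ℚ)
  let hi : ℚ := ∑ m ∈ Finset.range M, ((term m).hi : ℚ) / S / (2 * m + 1 / 2 : ℚ)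
  (lo, hi + ((term M).hi : ℚ) / S * (1 + 1 / (2 * (2 * b))) / (2 * M + 1 / 2 : ℚ))

/-- The tail check: all the needed exponential enclosures succeed. [folklore] -/
def archTailCheck (S Ke ke M : ℕ) (b : ℚ) : Bool :=
  (List.range (M + 1)).all fun m ↦ (MI.expPt S Ke ke (ofRat S (-((2 * m + 1 / 2 : ℚ) * (2 * b))))).isSome

/-- **Soundness of the tail bounds.** [folklore] -/
theorem archTail_sound {S : ℕ} (hS : 0 < S) {Ke ke M : ℕ} {b : ℚ} (hb : 0 < b)
    (hchk : archTailCheck S Ke ke M b = true) :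
    (((archTailBounds S Ke ke M b).1 : ℚ) : ℝ) ≤ ∫ t in Ioi (2 * (b : ℝ)), weilArchDensity t ∧
      ∫ t in Ioi (2 * (b : ℝ)), weilArchDensity t ≤ (((archTailBounds S Ke ke M b).2 : ℚ) : ℝ) := by
  unfold archTailCheck at hchk
  simp only [List.all_eq_true, List.mem_range] at hchk
  have hL : (0 : ℝ) < 2 * b := by linarith [(by exact_mod_cast hb : (0 : ℝ) < b)]
  obtain ⟨-, heq⟩ := weilArchDensity_tail_eq_sum_add hL M
  obtain ⟨-, hR0, hR1⟩ := weilArchDensity_tail_rem_le hL M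
  have hSr : (0 : ℝ) < S := by exact_mod_cast hS
  -- the exponential enclosures
  have hmem : ∀ m, m < M + 1 → MI.mem S (Real.exp (-((2 * m + 1 / 2) * (2 * (b : ℝ)))))
      (expRatMI S Ke ke (-((2 * m + 1 / 2 : ℚ) * (2 * b)))) := by
    intro m hm
    have := mem_expRatMI hS (hchk m hm)
    convert this using 2
    push_cast; ring
  have hterm : ∀ m ∈ Finset.range M,
      ((((expRatMI S Ke ke (-((2 * m + 1 / 2 : ℚ) * (2 * b)))).lo : ℚ) / S / (2 * m + 1 / 2 : ℚ) : ℚ) : ℝ) ≤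
        Real.exp (-((2 * m + 1 / 2) * (2 * (b : ℝ)))) / (2 * m + 1 / 2) ∧
      Real.exp (-((2 * m + 1 / 2) * (2 * (b : ℝ)))) / (2 * m + 1 / 2) ≤
        ((((expRatMI S Ke ke (-((2 * m + 1 / 2 : ℚ) * (2 * b)))).hi : ℚ) / S / (2 * m + 1 / 2 : ℚ) : ℚ) : ℝ) := by
    intro m hm
    have h := hmem m (Nat.lt_succ_of_lt (Finset.mem_range.1 hm))
    obtain ⟨h1, h2⟩ := h
    have ha : (0 : ℝ) < 2 * m + 1 / 2 := by positivity
    push_cast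
    constructor
    · rw [div_div, div_le_div_iff₀ (by positivity) ha]
      nlinarith
    · rw [div_div, div_le_div_iff₀ ha (by positivity)]
      nlinarith
  have hMhi : Real.exp (-((2 * M + 1 / 2) * (2 * (b : ℝ)))) ≤
      (((expRatMI S Ke ke (-((2 * M + 1 / 2 : ℚ) * (2 * b)))).hi : ℚ) : ℝ) / S := by
    have h := (hmem M (Nat.lt_succ_self M)).2
    rw [le_div_iff₀ hSr]; exact_mod_cast h
  rw [heq]
  unfold archTailBounds
  simp only []
  push_cast
  constructor
  · have : ∑ m ∈ Finset.range M,
        ((((expRatMI S Ke ke (-((2 * m + 1 / 2 : ℚ) * (2 * b)))).lo : ℚ) / S / (2 * m + 1 / 2 : ℚ) : ℚ) : ℝ) ≤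
        ∑ m ∈ Finset.range M, Real.exp (-((2 * m + 1 / 2) * (2 * (b : ℝ)))) / (2 * m + 1 / 2) :=
      Finset.sum_le_sum fun m hm ↦ (hterm m hm).1
    push_cast at this
    linarith
  · have : ∑ m ∈ Finset.range M, Real.exp (-((2 * m + 1 / 2) * (2 * (b : ℝ)))) / (2 * m + 1 / 2) ≤
        ∑ m ∈ Finset.range M,
          ((((expRatMI S Ke ke (-((2 * m + 1 / 2 : ℚ) * (2 * b)))).hi : ℚ) / S / (2 * m + 1 / 2 : ℚ) : ℚ) : ℝ) :=
      Finset.sum_le_sum fun m hm ↦ (hterm m hm).2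
    push_cast at this
    have hpos : (0 : ℝ) ≤ (1 + 1 / (2 * (2 * (b : ℝ)))) / (2 * M + 1 / 2) := by positivity
    have hR2 : ∫ t in Ioi (2 * (b : ℝ)), weilArchDensityRem M t ≤
        (((expRatMI S Ke ke (-((2 * M + 1 / 2 : ℚ) * (2 * b)))).hi : ℚ) : ℝ) / S *
          (1 + 1 / (2 * (2 * (b : ℝ)))) / (2 * M + 1 / 2) := by
      refine hR1.trans ?_
      rw [mul_div_assoc, mul_div_assoc]
      exact mul_le_mul_of_nonneg_right hMhi hpos
    push_cast at hR2
    linarith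

end Literature.NumberTheory.LFunctions
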